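import Mathlib
import Summits.Ventures.HodgeRepro2.T5RecordSatakeDifferent

/-!
# THE ABSOLUTE DIFFERENT OF A CM FIELD THROUGH THE TOWER `ℤ ⊆ 𝓞_{K⁺} ⊆ 𝓞_K`, AND THE KERNEL HALF OF CLAUSE (u2)

Tier-5 support N3 / §G-N4.2 (seat p3, gen 83). Files 313–319 bound the exceptional set of the record's Hecke
commutativity by the support of the RELATIVE different `𝔇_{K/K⁺}`. The remaining clause of §N3.10.3's finiteness
argument, (u2) «`ψ_v` has conductor `𝒪_v` outside the different», is about the different of `K⁺/ℚ`: this file puts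
its number-theoretic half in kernel — Mathlib's transitivity of the different and its unramifiedness criterion give,
for EVERY CM field `K`:

* **`differentIdeal_int_eq_mul_map`** — `𝔇_{K/ℚ} = 𝔇_{K/K⁺} · 𝔇_{K⁺/ℚ} 𝓞_K` (Mathlib's
  `differentIdeal_eq_differentIdeal_mul_differentIdeal` on the tower `ℤ ⊆ 𝓞_{K⁺} ⊆ 𝓞_K`);
* **`dvd_differentIdeal_int_iff`** / **`not_dvd_differentIdeal_int_iff`** — a prime `w` of `K` divides `𝔇_{K/ℚ}` iff
  it divides `𝔇_{K/K⁺}` or its contraction `v = w ∩ K⁺` divides `𝔇_{K⁺/ℚ}`;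
* **`ramificationIdx_int_eq_one_of_not_dvd`** — `w ∤ 𝔇_{K/ℚ} ⇒ e(w/p) = 1`; **`ramificationIdx_int_eq_one_iff`** —
  for a place `v` of `K⁺`, `v ∤ 𝔇_{K⁺/ℚ} ⟺ e(v/p) = 1` (THE KERNEL HALF OF (u2): the conductor of
  `ψ_v = ψ_p ∘ Tr_{K⁺_v/ℚ_p}` is the inverse different of `K⁺_v/ℚ_p`, trivial iff `e(v/p) = 1` — the additive
  character itself stays print);
* **`finite_setOf_dvd_differentIdeal_int`** — the places of `K⁺` dividing `𝔇_{K⁺/ℚ}` are finitely many;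
* **`natAbs_discr_eq_absNorm_differentIdeal_mul_sq`** — `|disc K| = N(𝔇_{K/K⁺}) · |disc K⁺|²` (Mathlib's
  discriminant–different tower formula, `[K : K⁺] = 2`);
* **`not_dvd_differentIdeal_int_of_discr_notMem`** / **`ramificationIdx_int_eq_one_of_discr_notMem`** — a place of
  `K⁺` not containing `disc K⁺` is prime to `𝔇_{K⁺/ℚ}` and unramified over `ℚ` («unramified outside the
  discriminant», Mathlib's `discr_mem_differentIdeal`).

§8(d): uses an L-value-free non-vanishing device: NO.
-/

open Matrix NumberField NumberField.IsCMField IsDedekindDomain IsDedekindDomain.HeightOneSpectrum Module Polynomial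
  Ideal

namespace Summit.Ventures.HodgeRepro2.T5RecordDifferentTower

section Tower

variable (K : Type*) [Field K] [NumberField K]

/-- **Transitivity of the different on the tower `ℤ ⊆ 𝓞_{K⁺} ⊆ 𝓞_K`**:
`𝔇_{K/ℚ} = 𝔇_{K/K⁺} · (𝔇_{K⁺/ℚ}) 𝓞_K` (Mathlib's `differentIdeal_eq_differentIdeal_mul_differentIdeal`). -/
theorem differentIdeal_int_eq_mul_map :
    differentIdeal ℤ (𝓞 K) =
      differentIdeal (𝓞 (maximalRealSubfield K)) (𝓞 K) *
        (differentIdeal ℤ (𝓞 (maximalRealSubfield K))).map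
          (algebraMap (𝓞 (maximalRealSubfield K)) (𝓞 K)) :=
  differentIdeal_eq_differentIdeal_mul_differentIdeal ℤ (𝓞 (maximalRealSubfield K)) (𝓞 K)

/-- A prime `w` of `K` divides the extension of an ideal `I` of `𝓞_{K⁺}` iff its contraction divides `I`
(`Ideal.map_le_iff_le_comap`). -/
theorem dvd_map_iff_under_dvd (w : HeightOneSpectrum (𝓞 K)) (I : Ideal (𝓞 (maximalRealSubfield K))) :
    w.asIdeal ∣ I.map (algebraMap (𝓞 (maximalRealSubfield K)) (𝓞 K)) ↔
      w.asIdeal.under (𝓞 (maximalRealSubfield K)) ∣ I := by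
  rw [Ideal.dvd_iff_le, Ideal.dvd_iff_le, Ideal.map_le_iff_le_comap]

/-- **A prime `w` of `K` divides the absolute different iff it divides the relative different or lies over a
prime divisor of `𝔇_{K⁺/ℚ}`** (the tower identity and the primality of `w`). -/
theorem dvd_differentIdeal_int_iff (w : HeightOneSpectrum (𝓞 K)) :
    w.asIdeal ∣ differentIdeal ℤ (𝓞 K) ↔
      w.asIdeal ∣ differentIdeal (𝓞 (maximalRealSubfield K)) (𝓞 K) ∨
        w.asIdeal.under (𝓞 (maximalRealSubfield K)) ∣ differentIdeal ℤ (𝓞 (maximalRealSubfield K)) := by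
  rw [differentIdeal_int_eq_mul_map K, ← dvd_map_iff_under_dvd K w]
  exact (Ideal.prime_of_isPrime w.ne_bot w.isPrime).dvd_mul

/-- **`w` is unramified over `ℚ` iff it is unramified over `K⁺` and its contraction is unramified over `ℚ`**, in the
language of the differents. -/
theorem not_dvd_differentIdeal_int_iff (w : HeightOneSpectrum (𝓞 K)) :
    ¬ w.asIdeal ∣ differentIdeal ℤ (𝓞 K) ↔
      ¬ w.asIdeal ∣ differentIdeal (𝓞 (maximalRealSubfield K)) (𝓞 K) ∧
        ¬ w.asIdeal.under (𝓞 (maximalRealSubfield K)) ∣ differentIdeal ℤ (𝓞 (maximalRealSubfield K)) := by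
  rw [dvd_differentIdeal_int_iff K w, not_or]

/-- `w ∤ 𝔇_{K/ℚ}` from the two relative conditions. -/
theorem not_dvd_differentIdeal_int_of (w : HeightOneSpectrum (𝓞 K))
    (h₁ : ¬ w.asIdeal ∣ differentIdeal (𝓞 (maximalRealSubfield K)) (𝓞 K))
    (h₂ : ¬ w.asIdeal.under (𝓞 (maximalRealSubfield K)) ∣ differentIdeal ℤ (𝓞 (maximalRealSubfield K))) :
    ¬ w.asIdeal ∣ differentIdeal ℤ (𝓞 K) :=
  (not_dvd_differentIdeal_int_iff K w).mpr ⟨h₁, h₂⟩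

end Tower

section Unramified

variable (K : Type*) [Field K] [NumberField K]

/-- **A prime of `K` not dividing the absolute different is unramified over `ℚ`: `e(w/p) = 1`** (Mathlib's
`not_dvd_differentIdeal_iff` and `ramificationIdx_eq_one`). -/
theorem ramificationIdx_int_eq_one_of_not_dvd (w : HeightOneSpectrum (𝓞 K))
    (h : ¬ w.asIdeal ∣ differentIdeal ℤ (𝓞 K)) : w.asIdeal.ramificationIdx ℤ = 1 := by
  haveI : Algebra.IsUnramifiedAt ℤ w.asIdeal := not_dvd_differentIdeal_iff.mp h
  exact Ideal.ramificationIdx_eq_one w.asIdeal ℤ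

/-- **THE KERNEL HALF OF CLAUSE (u2)**: a place `v` of `K⁺` (here: of any number field) does not divide the different
`𝔇_{K⁺/ℚ}` iff it is unramified over `ℚ`, `e(v/p) = 1` (Mathlib's `not_dvd_differentIdeal_iff` and
`ramificationIdx_eq_one_iff`; the residue field of `pℤ` is finite, hence perfect). -/
theorem ramificationIdx_int_eq_one_iff (v : HeightOneSpectrum (𝓞 K)) :
    ¬ v.asIdeal ∣ differentIdeal ℤ (𝓞 K) ↔ v.asIdeal.ramificationIdx ℤ = 1 := by
  rw [not_dvd_differentIdeal_iff, Ideal.ramificationIdx_eq_one_iff]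

/-- **The places dividing the different `𝔇_{K/ℚ}` form a finite set** (`𝔇 ≠ 0`, Mathlib's `Ideal.finite_factors`). -/
theorem finite_setOf_dvd_differentIdeal_int :
    {v : HeightOneSpectrum (𝓞 K) | v.asIdeal ∣ differentIdeal ℤ (𝓞 K)}.Finite :=
  Ideal.finite_factors differentIdeal_ne_bot

/-- The places of a number field ramified over `ℚ` form a finite set. -/
theorem finite_setOf_ramificationIdx_int_ne_one :
    {v : HeightOneSpectrum (𝓞 K) | v.asIdeal.ramificationIdx ℤ ≠ 1}.Finite := by
  refine (finite_setOf_dvd_differentIdeal_int K).subset fun v hv => ?_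
  by_contra h
  exact hv ((ramificationIdx_int_eq_one_iff K v).mp h)

/-- **`e(w/p) = 1` at every prime `w` of `K` prime to `𝔇_{K/K⁺}` whose contraction is prime to `𝔇_{K⁺/ℚ}`** — the
two relative conditions of files 313–317 and of clause (u2) give unramifiedness over `ℚ`. -/
theorem ramificationIdx_int_eq_one_of (w : HeightOneSpectrum (𝓞 K))
    (h₁ : ¬ w.asIdeal ∣ differentIdeal (𝓞 (maximalRealSubfield K)) (𝓞 K))
    (h₂ : ¬ w.asIdeal.under (𝓞 (maximalRealSubfield K)) ∣ differentIdeal ℤ (𝓞 (maximalRealSubfield K))) :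
    w.asIdeal.ramificationIdx ℤ = 1 :=
  ramificationIdx_int_eq_one_of_not_dvd K w (not_dvd_differentIdeal_int_of K w h₁ h₂)

end Unramified

section Discriminant

variable (K : Type*) [Field K] [NumberField K]

/-- **`disc K ∈ 𝔇_{K/ℚ}`** (Mathlib's `discr_mem_differentIdeal`), hence every prime divisor of the different
contains the discriminant. -/
theorem discr_mem_of_dvd_differentIdeal_int (v : HeightOneSpectrum (𝓞 K))
    (hv : v.asIdeal ∣ differentIdeal ℤ (𝓞 K)) : ((discr K : ℤ) : 𝓞 K) ∈ v.asIdeal :=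
  (Ideal.dvd_iff_le.mp hv) (discr_mem_differentIdeal K (𝓞 K))

/-- **A place not containing the discriminant is prime to the different**. -/
theorem not_dvd_differentIdeal_int_of_discr_notMem (v : HeightOneSpectrum (𝓞 K))
    (h : ((discr K : ℤ) : 𝓞 K) ∉ v.asIdeal) : ¬ v.asIdeal ∣ differentIdeal ℤ (𝓞 K) :=
  fun hv => h (discr_mem_of_dvd_differentIdeal_int K v hv)

/-- **UNRAMIFIED OUTSIDE THE DISCRIMINANT**: `e(v/p) = 1` at every place `v` not containing `disc K`. -/
theorem ramificationIdx_int_eq_one_of_discr_notMem (v : HeightOneSpectrum (𝓞 K))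
    (h : ((discr K : ℤ) : 𝓞 K) ∉ v.asIdeal) : v.asIdeal.ramificationIdx ℤ = 1 :=
  ramificationIdx_int_eq_one_of_not_dvd K v (not_dvd_differentIdeal_int_of_discr_notMem K v h)

/-- The places containing the discriminant form a finite set (`disc K ≠ 0`, Mathlib's `Ideal.finite_factors` on the
principal ideal). -/
theorem finite_setOf_discr_mem :
    {v : HeightOneSpectrum (𝓞 K) | ((discr K : ℤ) : 𝓞 K) ∈ v.asIdeal}.Finite := by
  have hne : span {((discr K : ℤ) : 𝓞 K)} ≠ 0 := by
    rw [Submodule.zero_eq_bot, ne_eq, span_singleton_eq_bot]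
    exact_mod_cast discr_ne_zero K
  refine (Ideal.finite_factors hne).subset fun v hv => ?_
  rw [Set.mem_setOf_eq, Ideal.dvd_iff_le, span_singleton_le_iff_mem]
  exact hv

end Discriminant

section CM

variable (K : Type*) [Field K] [NumberField K] [IsCMField K]

/-- **`|disc K| = N(𝔇_{K/K⁺}) · |disc K⁺|²`** for a CM field (Mathlib's discriminant–different tower formula
`natAbs_discr_eq_absNorm_differentIdeal_mul_natAbs_discr_pow`, with `[K : K⁺] = 2`). -/
theorem natAbs_discr_eq_absNorm_differentIdeal_mul_sq :
    (discr K).natAbs =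
      Ideal.absNorm (differentIdeal (𝓞 (maximalRealSubfield K)) (𝓞 K)) *
        (discr (maximalRealSubfield K)).natAbs ^ 2 := by
  rw [natAbs_discr_eq_absNorm_differentIdeal_mul_natAbs_discr_pow (maximalRealSubfield K)
    (𝓞 (maximalRealSubfield K)) K (𝓞 K),
    Algebra.IsQuadraticExtension.finrank_eq_two (maximalRealSubfield K) K]

end CM

end Summit.Ventures.HodgeRepro2.T5RecordDifferentTower
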